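import Literature.InformationTheory.QuantumCodes.ExtremalTypeIWeightEnumerators
import Literature.InformationTheory.QuantumCodes.SExtremalAdditiveCodes
import HarnessLib

/-!
# The weight enumerator of an s-extremal additive self-dual code is unique (Bautista–Gaborit–Kim–Walker 2007)

[cite: BautistaEtAl2007, §2 Rem. 2.7 and §3 (proof of Thm. 3.3); Rains1998Shadow, §II Thm. 2]

BGKW07 Remark 2.7: «the weight enumerator of any s-extremal code is uniquely determined and can be explicitly
computed» — for an odd self-dual additive `(n, 2ⁿ)` code over `𝔽₄` with minimum distance `d` and shadow minimum
weight `s = n + 2 − 2d`, Gleason's theorem `W = Σ_{i ≤ n/2} c_i (x+y)^{n−2i}(x²+3y²)^i` (CRSS98 Thm. 16 (a)) and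
`S(y) = Σ_i c_i 2^{n−2i} y^{n−2i}(1+3y²)^i` (BGKW07 Thm. 3.1) give a square triangular system: `S_w = 0` for
`w ≤ n − 2d` forces `c_i = 0` for `i ≥ d` (the term `i` has `y`-valuation `n − 2i`), and then `A_1 = ⋯ = A_{d−1} = 0`
forces the rest, after the change of basis `x² + 3y² = (x+y)² − 2y(x−y)` which makes the Gleason basis
`y`-adically triangular. We prove exactly this, for all `n` (no `n ≤ 3d − 3` restriction):

* `gleason_coeffs_unique` — the algebraic core: if `Σ_j a_j X^j = Σ_i δ_i (1+X)^{n−2i}(1+3X²)^i`,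
  `Σ_w b_w X^w = Σ_i δ_i 2^{n−2i} X^{n−2i}(1+3X²)^i`, `a_j = 0` for `j < d` and `b_w = 0` for `w ≤ n − 2d`, then `a = 0`
  on `[0, n]`;
* `BautistaEtAl2007_remark2_7` — two odd self-dual `[[n, 0, d]]` additive codes whose shadow words all have weight
  `≥ n + 2 − 2d` have the same weight distribution;
* `extremal_six_mul_add_five_wtDist_unique` — the exceptional s-extremal family: any two `[[6m+5, 0, 2m+3]]` additive
  codes have the same weight distribution (purity + Rains's identities `S_w = 0`, `w ≤ 2m+1`);
* `wtDist_eq_of_eq_low_of_rainsShadow_eq` — code form of the core: `A_j (j < d)` and `S_w (w ≤ n − 2d)` determine `W`.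
-/

open Finset Polynomial

namespace Literature.InformationTheory.QuantumCodes

variable {n : ℕ}

namespace SExtremalUnique

-- The `y`-adically triangular Gleason basis element is `h_l = (1+X)^{n−2l} (X(1−X))^l` (written out in full below).

/-- `[X^m] h_l = 0` for `m < l`. [cite: BautistaEtAl2007, §3] -/
theorem coeff_hPoly_of_lt {n l m : ℕ} (h : m < l) :
    (((1 : Polynomial ℝ) + X) ^ (n - 2 * l) * (X * (1 - X)) ^ l).coeff m = 0 := by
  rw [mul_pow, ← mul_assoc, mul_comm (((1 : Polynomial ℝ) + X) ^ (n - 2 * l)), mul_assoc,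
    Polynomial.coeff_X_pow_mul', if_neg (not_le.2 h)]

/-- `[X^l] h_l = 1`. [cite: BautistaEtAl2007, §3] -/
theorem coeff_hPoly_self (n l : ℕ) :
    (((1 : Polynomial ℝ) + X) ^ (n - 2 * l) * (X * (1 - X)) ^ l).coeff l = 1 := by
  rw [mul_pow, ← mul_assoc, mul_comm (((1 : Polynomial ℝ) + X) ^ (n - 2 * l)), mul_assoc,
    Polynomial.coeff_X_pow_mul', if_pos le_rfl, Nat.sub_self, Polynomial.coeff_zero_eq_eval_zero]
  simp

/-- `[X^m] (X^{n−2i} (1+3X²)^i) = 0` for `m < n − 2i`. [cite: BautistaEtAl2007, Thm. 3.1] -/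
theorem coeff_shadowBasis_of_lt {n i m : ℕ} (h : m < n - 2 * i) :
    ((X : Polynomial ℝ) ^ (n - 2 * i) * (1 + 3 * X ^ 2) ^ i).coeff m = 0 := by
  rw [Polynomial.coeff_X_pow_mul', if_neg (not_le.2 h)]

/-- `[X^{n−2i}] (X^{n−2i} (1+3X²)^i) = 1`. [cite: BautistaEtAl2007, Thm. 3.1] -/
theorem coeff_shadowBasis_self (n i : ℕ) :
    ((X : Polynomial ℝ) ^ (n - 2 * i) * (1 + 3 * X ^ 2) ^ i).coeff (n - 2 * i) = 1 := by
  rw [Polynomial.coeff_X_pow_mul', if_pos le_rfl, Nat.sub_self, Polynomial.coeff_zero_eq_eval_zero]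
  simp

/-- Change of basis `x² + 3y² = (x+y)² − 2y(x−y)`: for `i ≤ n/2`,
`(1+X)^{n−2i}(1+3X²)^i = Σ_{l ≤ i} C(i,l)(−2)^l · h_l`. [cite: BautistaEtAl2007, §3] -/
theorem gleasonBasis_eq_sum_hPoly {n i : ℕ} (hi : 2 * i ≤ n) (d : ℕ) (hid : i < d) :
    ((1 : Polynomial ℝ) + X) ^ (n - 2 * i) * (1 + 3 * X ^ 2) ^ i =
      ∑ l ∈ range d, C (if l ≤ i then ((i.choose l : ℕ) : ℝ) * (-2) ^ l else 0) *
        (((1 : Polynomial ℝ) + X) ^ (n - 2 * l) * (X * (1 - X)) ^ l) := by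
  have hb : (1 : Polynomial ℝ) + 3 * X ^ 2 = (C (-2 : ℝ) * (X * (1 - X))) + (1 + X) ^ 2 := by
    rw [map_neg, map_ofNat]; ring
  rw [hb, add_pow (C (-2 : ℝ) * (X * (1 - X))) (((1 : Polynomial ℝ) + X) ^ 2) i, mul_sum]
  -- restrict the range-`d` sum to `l ≤ i`
  rw [← sum_range_add_sum_Ico _ (show i + 1 ≤ d by omega),
    show ∑ l ∈ Ico (i + 1) d, C (if l ≤ i then ((i.choose l : ℕ) : ℝ) * (-2) ^ l else 0) *
        (((1 : Polynomial ℝ) + X) ^ (n - 2 * l) * (X * (1 - X)) ^ l) = 0 from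
      sum_eq_zero fun l hl => by rw [mem_Ico] at hl; rw [if_neg (by omega), map_zero, zero_mul], add_zero]
  refine sum_congr rfl fun l hl => ?_
  rw [mem_range] at hl
  rw [if_pos (by omega)]
  have he : n - 2 * l = n - 2 * i + 2 * (i - l) := by omega
  rw [he, pow_add, pow_mul, map_mul, map_pow, map_natCast, mul_pow (C (-2 : ℝ)) (X * (1 - X)) l]
  ring

/-- Coefficient extraction from `Σ_{j<N} C(f j) X^j`. [folklore] -/
private theorem coeff_sum_C_mul_X_pow (f : ℕ → ℝ) {N m : ℕ} (hm : m < N) :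
    (∑ j ∈ range N, C (f j) * X ^ j).coeff m = f m := by
  simp only [finsetSum_coeff, coeff_C_mul_X_pow]
  rw [sum_ite_eq, if_pos (mem_range.2 hm)]

/-- Coefficient extraction from `Σ_{i<N} C(g i) · Q_i`. [folklore] -/
private theorem coeff_sum_C_mul (g : ℕ → ℝ) (Q : ℕ → Polynomial ℝ) (N m : ℕ) :
    (∑ i ∈ range N, C (g i) * Q i).coeff m = ∑ i ∈ range N, g i * (Q i).coeff m := by
  simp only [finsetSum_coeff, coeff_C_mul]

variable {d : ℕ} {a b δ : ℕ → ℝ}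

/-- **Step 1** (shadow side): `b_w = 0` for `w ≤ n − 2d` forces `δ_i = 0` for `d ≤ i ≤ n/2` — the term `i` of
`Σ_i δ_i 2^{n−2i} X^{n−2i}(1+3X²)^i` is the only one reaching `X^{n−2i}` among `i' ≤ i`. [cite: BautistaEtAl2007, §3] -/
theorem delta_eq_zero_of_ge
    (hS : ∑ w ∈ range (n + 1), C (b w) * X ^ w =
      ∑ i ∈ range (n / 2 + 1), C (δ i * 2 ^ (n - 2 * i)) * ((X : Polynomial ℝ) ^ (n - 2 * i) * (1 + 3 * X ^ 2) ^ i))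
    (hb : ∀ w, w ≤ n - 2 * d → b w = 0) :
    ∀ i, d ≤ i → i ≤ n / 2 → δ i = 0 := by
  -- downward strong induction on `i`
  suffices H : ∀ m i, n / 2 - i ≤ m → d ≤ i → i ≤ n / 2 → δ i = 0 from fun i hdi hi => H _ i le_rfl hdi hi
  intro m
  induction m with
  | zero => intro i hm hdi hi; exact step i hdi hi fun i' hi' hi'2 => by omega
  | succ m ih => intro i hm hdi hi; exact step i hdi hi fun i' hi' hi'2 => ih i' (by omega) (by omega) hi'2
where
  step (i : ℕ) (hdi : d ≤ i) (hi : i ≤ n / 2) (IH : ∀ i', i < i' → i' ≤ n / 2 → δ i' = 0) : δ i = 0 := by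
    have h := congrArg (fun P : Polynomial ℝ => P.coeff (n - 2 * i)) hS
    rw [coeff_sum_C_mul_X_pow _ (by omega), hb _ (by omega), coeff_sum_C_mul, sum_eq_single i,
      coeff_shadowBasis_self, mul_one] at h
    · have h2 : (2 : ℝ) ^ (n - 2 * i) ≠ 0 := pow_ne_zero _ two_ne_zero
      rcases mul_eq_zero.1 h.symm with h0 | h0
      · exact h0
      · exact absurd h0 h2
    · intro i' hi' hne
      rw [mem_range] at hi'
      rcases lt_or_gt_of_ne hne with hlt | hgt
      · rw [coeff_shadowBasis_of_lt (by omega), mul_zero]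
      · rw [IH i' hgt (by omega), zero_mul, zero_mul]
    · intro hi'; exact absurd (mem_range.2 (by omega)) hi'

/-- **Step 2** (code side): with `δ_i = 0` for `i ≥ d`, the identity `Σ_j a_j X^j = Σ_{i<d} δ_i (1+X)^{n−2i}(1+3X²)^i`
and `a_j = 0` for `j < d` force `Σ_j a_j X^j = 0`, via the triangular basis `h_l`. [cite: BautistaEtAl2007, §3] -/
theorem poly_eq_zero
    (hW : ∑ j ∈ range (n + 1), C (a j) * X ^ j =
      ∑ i ∈ range (n / 2 + 1), C (δ i) * (((1 : Polynomial ℝ) + X) ^ (n - 2 * i) * (1 + 3 * X ^ 2) ^ i))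
    (ha : ∀ j, j < d → a j = 0) (hδ : ∀ i, d ≤ i → i ≤ n / 2 → δ i = 0) (hd : d ≤ n / 2 + 1) :
    ∑ j ∈ range (n + 1), C (a j) * X ^ j = 0 := by
  -- rewrite the right-hand side in the basis `h_l`, `l < d`
  set e : ℕ → ℕ → ℝ := fun i l => if l ≤ i then ((i.choose l : ℕ) : ℝ) * (-2) ^ l else 0 with he
  set δ' : ℕ → ℝ := fun l => ∑ i ∈ range d, δ i * e i l with hδ'
  have hR : ∑ i ∈ range (n / 2 + 1), C (δ i) * (((1 : Polynomial ℝ) + X) ^ (n - 2 * i) * (1 + 3 * X ^ 2) ^ i)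
      = ∑ l ∈ range d, C (δ' l) * (((1 : Polynomial ℝ) + X) ^ (n - 2 * l) * (X * (1 - X)) ^ l) := by
    rw [← sum_range_add_sum_Ico _ hd,
      show ∑ i ∈ Ico d (n / 2 + 1), C (δ i) * (((1 : Polynomial ℝ) + X) ^ (n - 2 * i) * (1 + 3 * X ^ 2) ^ i) = 0 from
        sum_eq_zero fun i hi => by rw [mem_Ico] at hi; rw [hδ i hi.1 (by omega), map_zero, zero_mul], add_zero]
    have : ∀ i ∈ range d, C (δ i) * (((1 : Polynomial ℝ) + X) ^ (n - 2 * i) * (1 + 3 * X ^ 2) ^ i)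
        = ∑ l ∈ range d, C (δ i * e i l) * (((1 : Polynomial ℝ) + X) ^ (n - 2 * l) * (X * (1 - X)) ^ l) := by
      intro i hi
      rw [mem_range] at hi
      rw [gleasonBasis_eq_sum_hPoly (by omega) d hi, mul_sum]
      refine sum_congr rfl fun l _ => ?_
      rw [map_mul, mul_assoc]
    rw [sum_congr rfl this, sum_comm]
    refine sum_congr rfl fun l _ => ?_
    rw [hδ', map_sum, sum_mul]
  rw [hR] at hW
  -- all `δ' l`, `l < d`, vanish: upward strong induction using the triangularity of `h_l`
  have hz : ∀ l, l < d → δ' l = 0 := by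
    intro l
    induction l using Nat.strong_induction_on with
    | _ l ih =>
      intro hl
      have h := congrArg (fun P : Polynomial ℝ => P.coeff l) hW
      rw [coeff_sum_C_mul_X_pow _ (by omega), ha l hl, coeff_sum_C_mul, sum_eq_single l, coeff_hPoly_self,
        mul_one] at h
      · exact h.symm
      · intro l' hl' hne
        rcases lt_or_gt_of_ne hne with hlt | hgt
        · rw [ih l' hlt (by rw [mem_range] at hl'; exact hl'), zero_mul]
        · rw [coeff_hPoly_of_lt hgt, mul_zero]
      · intro hl'; exact absurd (mem_range.2 hl) hl'
  rw [hW]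
  exact sum_eq_zero fun l hl => by rw [hz l (mem_range.1 hl), map_zero, zero_mul]

/-- **The algebraic core**: the constraints `a_j = 0 (j < d)`, `b_w = 0 (w ≤ n − 2d)` on a Gleason pair force `a = 0`
on `[0, n]`. [cite: BautistaEtAl2007, Rem. 2.7 and §3] -/
theorem gleason_coeffs_unique
    (hW : ∑ j ∈ range (n + 1), C (a j) * X ^ j =
      ∑ i ∈ range (n / 2 + 1), C (δ i) * (((1 : Polynomial ℝ) + X) ^ (n - 2 * i) * (1 + 3 * X ^ 2) ^ i))
    (hS : ∑ w ∈ range (n + 1), C (b w) * X ^ w =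
      ∑ i ∈ range (n / 2 + 1), C (δ i * 2 ^ (n - 2 * i)) * ((X : Polynomial ℝ) ^ (n - 2 * i) * (1 + 3 * X ^ 2) ^ i))
    (ha : ∀ j, j < d → a j = 0) (hb : ∀ w, w ≤ n - 2 * d → b w = 0) (hd : d ≤ n / 2 + 1) :
    ∀ j, j ≤ n → a j = 0 := by
  have h0 := poly_eq_zero hW ha (delta_eq_zero_of_ge hS hb) hd
  intro j hj
  have h := congrArg (fun P : Polynomial ℝ => P.coeff j) h0
  rwa [coeff_sum_C_mul_X_pow _ (by omega), coeff_zero] at h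

end SExtremalUnique

/-- No code word has weight `> n`. [folklore] -/
private theorem wtDist_eq_zero_of_lt {S : Submodule (ZMod 2) (SympVec n)} {j : ℕ} (h : n < j) : wtDist S j = 0 := by
  classical
  rw [wtDist, Finset.card_eq_zero, Finset.filter_eq_empty_iff]
  intro v _ hv
  have := sympWeight_le v
  omega

/-- The shadow coefficients of an odd self-dual code whose shadow words have weight `≥ n + 2 − 2d` vanish up to
`n − 2d`. [cite: BautistaEtAl2007, §2 Def. 2.4] -/
theorem rainsShadow_wtDist_eq_zero_of_sExtremal {d : ℕ} {S : Submodule (ZMod 2) (SympVec n)}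
    (hC : IsAdditiveCode S 0 d) (hodd : ¬ IsEvenCode S)
    (hs : ∀ w ∈ sympDual (evenSub S hC.1), w ∉ S → n + 2 ≤ 2 * d + sympWeight w) {w : ℕ} (hw : w ≤ n - 2 * d) :
    rainsShadow n (fun j => (wtDist S j : ℝ)) w = 0 := by
  by_contra hne
  have hpos : 0 < rainsShadow n (fun i => (wtDist S i : ℝ)) w :=
    lt_of_le_of_ne ((hC.rainsLP_wtDist).2.2.2 _) (Ne.symm hne)
  obtain ⟨v, hv, hvS, hvw⟩ := exists_shadow_of_rainsShadow_wtDist_pos hC.1 hC.sympDual_eq_self hodd hpos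
  have := hs v hv hvS
  have hv0 : sympWeight v ≠ 0 := fun hw0 => hvS (by rw [(sympWeight_eq_zero_iff v).1 hw0]; exact S.zero_mem)
  omega

/-- **BGKW07 Remark 2.7 — the weight enumerator of an s-extremal code is uniquely determined**: two odd self-dual
`[[n, 0, d]]` additive codes all of whose shadow words have weight `≥ n + 2 − 2d` have the same weight distribution
(all `n`; by Thm. 2.5 such codes are exactly the s-extremal ones when `d` is their true minimum distance).
[cite: BautistaEtAl2007, §2 Rem. 2.7 («the weight enumerator of any s-extremal code is uniquely determined and can
be explicitly computed») and §3] -/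
theorem BautistaEtAl2007_remark2_7 {d : ℕ} {S S' : Submodule (ZMod 2) (SympVec n)}
    (hC : IsAdditiveCode S 0 d) (hC' : IsAdditiveCode S' 0 d) (hodd : ¬ IsEvenCode S) (hodd' : ¬ IsEvenCode S')
    (hs : ∀ w ∈ sympDual (evenSub S hC.1), w ∉ S → n + 2 ≤ 2 * d + sympWeight w)
    (hs' : ∀ w ∈ sympDual (evenSub S' hC'.1), w ∉ S' → n + 2 ≤ 2 * d + sympWeight w) (j : ℕ) :
    wtDist S j = wtDist S' j := by
  classical
  by_cases hjn : n < j
  · rw [wtDist_eq_zero_of_lt hjn, wtDist_eq_zero_of_lt hjn]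
  push Not at hjn
  obtain ⟨c, hc⟩ := exists_gleason_coeffs hC.sympDual_eq_self
  obtain ⟨c', hc'⟩ := exists_gleason_coeffs hC'.sympDual_eq_self
  obtain ⟨h0, hpure, -, -⟩ := hC.rainsLP_wtDist
  obtain ⟨h0', hpure', -, -⟩ := hC'.rainsLP_wtDist
  -- the differences
  have hW : ∑ j ∈ range (n + 1), C ((wtDist S j : ℝ) - (wtDist S' j : ℝ)) * X ^ j =
      ∑ i ∈ range (n / 2 + 1), C ((c i : ℝ) - (c' i : ℝ)) *
        (((1 : Polynomial ℝ) + X) ^ (n - 2 * i) * (1 + 3 * X ^ 2) ^ i) := by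
    simp only [map_sub, sub_mul, sum_sub_distrib, poly_wtDist_eq hc, poly_wtDist_eq hc']
  have hS : ∑ w ∈ range (n + 1), C (rainsShadow n (fun j => (wtDist S j : ℝ)) w
        - rainsShadow n (fun j => (wtDist S' j : ℝ)) w) * X ^ w =
      ∑ i ∈ range (n / 2 + 1), C (((c i : ℝ) - (c' i : ℝ)) * 2 ^ (n - 2 * i)) *
        ((X : Polynomial ℝ) ^ (n - 2 * i) * (1 + 3 * X ^ 2) ^ i) := by
    simp only [map_sub, sub_mul, sum_sub_distrib, poly_rainsShadow_eq hc, poly_rainsShadow_eq hc', map_mul]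
  -- `d ≤ n/2 + 1`: an odd code of length `n` has a word of odd weight `≤ n`, so `d ≤ n`; sharper is not needed
  -- when `d > n/2 + 1` we have `n - 2d = 0`-ish and Step 1 is vacuous; we handle it by truncating `d`.
  by_cases hd : d ≤ n / 2 + 1
  · have key := SExtremalUnique.gleason_coeffs_unique (d := d) hW hS (fun j hj => ?_) (fun w hw => ?_) hd j hjn
    · have : (wtDist S j : ℝ) = (wtDist S' j : ℝ) := sub_eq_zero.1 key
      exact_mod_cast this
    · rcases Nat.eq_zero_or_pos j with rfl | hj0
      · rw [h0, h0', sub_self]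
      · rw [hpure j hj0 hj, hpure' j hj0 hj, sub_self]
    · rw [rainsShadow_wtDist_eq_zero_of_sExtremal hC hodd hs hw, rainsShadow_wtDist_eq_zero_of_sExtremal hC' hodd' hs' hw,
        sub_self]
  · -- `d ≥ n/2 + 2`: use `d₀ = n/2 + 1 ≤ d` (purity up to `d₀` and `n - 2 d₀ = 0`-range shadow vanishing still hold)
    push Not at hd
    have key := SExtremalUnique.gleason_coeffs_unique (d := n / 2 + 1) hW hS (fun j hj => ?_) (fun w hw => ?_) le_rfl j hjn
    · have : (wtDist S j : ℝ) = (wtDist S' j : ℝ) := sub_eq_zero.1 key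
      exact_mod_cast this
    · rcases Nat.eq_zero_or_pos j with rfl | hj0
      · rw [h0, h0', sub_self]
      · rw [hpure j hj0 (by omega), hpure' j hj0 (by omega), sub_self]
    · have hw' : w ≤ n - 2 * d := by omega
      rw [rainsShadow_wtDist_eq_zero_of_sExtremal hC hodd hs hw', rainsShadow_wtDist_eq_zero_of_sExtremal hC' hodd' hs' hw',
        sub_self]

/-- The shadow coefficients `S_w`, `w ≤ 2m+1`, of a `[[6m+5, 0, 2m+3]]` additive code vanish (Rains's identities at
`n = 6m+5`, `ShadowBound.rainsLPPure_six_mul_add_five_shadow_odd`, and `S_w = 0` for even `w`).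
[cite: Rains1998Shadow, §IV Thm. 2 and p. 138; BautistaEtAl2007, Thm. 2.5 (ii)] -/
theorem rainsShadow_wtDist_eq_zero_six_mul_add_five {m : ℕ} {S : Submodule (ZMod 2) (SympVec (6 * m + 5))}
    (hC : IsAdditiveCode S 0 (2 * m + 3)) {w : ℕ} (hw : w ≤ 2 * m + 1) :
    rainsShadow (6 * m + 5) (fun j => (wtDist S j : ℝ)) w = 0 := by
  rcases Nat.even_or_odd w with hev | ⟨j, rfl⟩
  · exact rainsShadow_wtDist_eq_zero_of_even hC ⟨3 * m + 2, by ring⟩ hev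
  · obtain ⟨h0, hpure, heq, hsh⟩ := hC.rainsLP_wtDist
    exact ShadowBound.rainsLPPure_six_mul_add_five_shadow_odd (A := fun j => (wtDist S j : ℝ)) h0 hpure
      (fun i _ => heq i) (fun i _ => hsh i) (by omega)

/-- **The weight enumerator of a `[[6m+5, 0, 2m+3]]` additive code is unique** (the exceptional s-extremal family of
BGKW07 Thm. 2.5 (ii) / Rem. 2.7: `n = 6m + 5`, `d = 2m + 3`, `2d + s = n + 4`): any two such codes have the same weight
distribution, for all `m` (the tree's instances: `wtDist_5_0_3`, `wtDist_11_0_5`, `wtDist_17_0_7`, `wtDist_23_0_9`,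
`wtDist_29_0_11`). Here purity gives `A_j = A'_j` for `j < 2m+3` and Rains's identities give `S_w = S'_w = 0` for
`w ≤ 2m+1 ⊇ [0, n − 2d]`, so `SExtremalUnique.gleason_coeffs_unique` applies.
[cite: BautistaEtAl2007, §2 Thm. 2.5 (ii) and Rem. 2.7; Rains1998Shadow, §IV Thm. 2] -/
theorem extremal_six_mul_add_five_wtDist_unique {m : ℕ} {S S' : Submodule (ZMod 2) (SympVec (6 * m + 5))}
    (hC : IsAdditiveCode S 0 (2 * m + 3)) (hC' : IsAdditiveCode S' 0 (2 * m + 3)) (j : ℕ) :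
    wtDist S j = wtDist S' j := by
  classical
  by_cases hjn : 6 * m + 5 < j
  · rw [wtDist_eq_zero_of_lt hjn, wtDist_eq_zero_of_lt hjn]
  push Not at hjn
  obtain ⟨c, hc⟩ := exists_gleason_coeffs hC.sympDual_eq_self
  obtain ⟨c', hc'⟩ := exists_gleason_coeffs hC'.sympDual_eq_self
  obtain ⟨h0, hpure, -, -⟩ := hC.rainsLP_wtDist
  obtain ⟨h0', hpure', -, -⟩ := hC'.rainsLP_wtDist
  have hW : ∑ j ∈ range (6 * m + 5 + 1), C ((wtDist S j : ℝ) - (wtDist S' j : ℝ)) * X ^ j =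
      ∑ i ∈ range ((6 * m + 5) / 2 + 1), C ((c i : ℝ) - (c' i : ℝ)) *
        (((1 : Polynomial ℝ) + X) ^ (6 * m + 5 - 2 * i) * (1 + 3 * X ^ 2) ^ i) := by
    simp only [map_sub, sub_mul, sum_sub_distrib, poly_wtDist_eq hc, poly_wtDist_eq hc']
  have hS : ∑ w ∈ range (6 * m + 5 + 1), C (rainsShadow (6 * m + 5) (fun j => (wtDist S j : ℝ)) w
        - rainsShadow (6 * m + 5) (fun j => (wtDist S' j : ℝ)) w) * X ^ w =
      ∑ i ∈ range ((6 * m + 5) / 2 + 1), C (((c i : ℝ) - (c' i : ℝ)) * 2 ^ (6 * m + 5 - 2 * i)) *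
        ((X : Polynomial ℝ) ^ (6 * m + 5 - 2 * i) * (1 + 3 * X ^ 2) ^ i) := by
    simp only [map_sub, sub_mul, sum_sub_distrib, poly_rainsShadow_eq hc, poly_rainsShadow_eq hc', map_mul]
  have key := SExtremalUnique.gleason_coeffs_unique (d := 2 * m + 3) hW hS (fun j hj => ?_) (fun w hw => ?_)
    (by omega) j hjn
  · have : (wtDist S j : ℝ) = (wtDist S' j : ℝ) := sub_eq_zero.1 key
    exact_mod_cast this
  · rcases Nat.eq_zero_or_pos j with rfl | hj0
    · rw [h0, h0', sub_self]
    · rw [hpure j hj0 hj, hpure' j hj0 hj, sub_self]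
  · rw [rainsShadow_wtDist_eq_zero_six_mul_add_five hC (by omega),
      rainsShadow_wtDist_eq_zero_six_mul_add_five hC' (by omega), sub_self]

/-- **Low coefficients of `W` and of the shadow enumerator determine `W`** (the mechanism behind BGKW07 Rem. 2.7, in code
form; consequence drawn here from Gleason's theorem CRSS98 Thm. 16 (a) and the shadow transform BGKW07 Thm. 3.1 — the
filer located no printed statement of this general form): two self-dual additive codes of length `n` with
`A_j = A'_j` for `j < d` and equal Rains shadow coefficients `S_w = S'_w` for `w ≤ n − 2d` (some `d ≤ n/2 + 1`) have the
same weight distribution. [cite: BautistaEtAl2007, §2 Rem. 2.7 and Thm. 3.1; CalderbankEtAl1998, Thm. 16 (a)] -/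
theorem wtDist_eq_of_eq_low_of_rainsShadow_eq {d : ℕ} {S S' : Submodule (ZMod 2) (SympVec n)}
    (hSD : sympDual S = S) (hSD' : sympDual S' = S') (hd : d ≤ n / 2 + 1)
    (hA : ∀ j, j < d → wtDist S j = wtDist S' j)
    (hSh : ∀ w, w ≤ n - 2 * d →
      rainsShadow n (fun j => (wtDist S j : ℝ)) w = rainsShadow n (fun j => (wtDist S' j : ℝ)) w) (j : ℕ) :
    wtDist S j = wtDist S' j := by
  classical
  by_cases hjn : n < j
  · rw [wtDist_eq_zero_of_lt hjn, wtDist_eq_zero_of_lt hjn]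
  push Not at hjn
  obtain ⟨c, hc⟩ := exists_gleason_coeffs hSD
  obtain ⟨c', hc'⟩ := exists_gleason_coeffs hSD'
  have hW : ∑ j ∈ range (n + 1), C ((wtDist S j : ℝ) - (wtDist S' j : ℝ)) * X ^ j =
      ∑ i ∈ range (n / 2 + 1), C ((c i : ℝ) - (c' i : ℝ)) *
        (((1 : Polynomial ℝ) + X) ^ (n - 2 * i) * (1 + 3 * X ^ 2) ^ i) := by
    simp only [map_sub, sub_mul, sum_sub_distrib, poly_wtDist_eq hc, poly_wtDist_eq hc']
  have hS : ∑ w ∈ range (n + 1), C (rainsShadow n (fun j => (wtDist S j : ℝ)) w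
        - rainsShadow n (fun j => (wtDist S' j : ℝ)) w) * X ^ w =
      ∑ i ∈ range (n / 2 + 1), C (((c i : ℝ) - (c' i : ℝ)) * 2 ^ (n - 2 * i)) *
        ((X : Polynomial ℝ) ^ (n - 2 * i) * (1 + 3 * X ^ 2) ^ i) := by
    simp only [map_sub, sub_mul, sum_sub_distrib, poly_rainsShadow_eq hc, poly_rainsShadow_eq hc', map_mul]
  have key := SExtremalUnique.gleason_coeffs_unique (d := d) hW hS
    (fun j hj => by rw [hA j hj, sub_self]) (fun w hw => by rw [hSh w hw, sub_self]) hd j hjn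
  have : (wtDist S j : ℝ) = (wtDist S' j : ℝ) := sub_eq_zero.1 key
  exact_mod_cast this

end Literature.InformationTheory.QuantumCodes
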